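import Mathlib.Analysis.SpecificLimits.Basic
import Literature.Barriers.CriticalPhenomena.WeaklySAWCouplingFlowRemainder
import HarnessLib

/-!
# The perturbed flow of the coupling constant: the weighted sums `Σ_{l<k} χ_lǧ_l = O(|log ǧ_k|)`
# under Assumption (A1), and `ǧ_∞ ∼ 1/Σ_jβ_j` with all inputs of §8.3 discharged except the flow
# (Bauerschmidt–Brydges–Slade 2015, §8.3; [BBS-rg-flow], Assumption (A1), Lemma 2.1(ii)(a), n = 1)

Continuation of `WeaklySAWCouplingFlowRemainder.lean` (theorems only). There, the second lemma of
§8.3 of R. Bauerschmidt, D. C. Brydges, G. Slade, CMP 337 (2015), arXiv:1403.7422 — `ǧ_∞ ∼ 1/𝖡_{m²}`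
for the PERTURBED recursion `ǧ_{j+1} = ǧ_j - β_jǧ_j² + r_j`, `|r_j| ≤ ρ_jǧ_j²` — is proved with the
summed remainder bound `Σ_jρ_j` carried along explicitly, the source's input
"`Σ_{l<k} r_lǧ_l⁻² = O(Σ_{l<k} χ_lḡ_l) = O(log ǧ_k)` by (e:chigbd-bis)" (the case `n = 1` of
[BBS-rg-flow, Lemma 2.1(ii)(a)], `Σ_{l=j}^k χ_lḡ_l ≤ C|log ḡ_k|`) entering only as the hypothesis
`Σ_jρ_j ≤ A + A'|log ǧ_∞|` of the final statement. This file proves that input for the perturbed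
flow itself, from the structure that the source's Assumption (A1) and the definition of the cut-off
time `j_Ω` give to the sequences `β` and `χ_j = Ω^{-(j-j_Ω)₊}` ([BBS-rg-flow], §1.2, (A1): "there
exists `c > 0` such that `β_j ≥ c` for all but `c⁻¹` values of `j ≤ j_Ω`"; `χ_j = 1` for `j ≤ j_Ω`
and `χ_j = Ω^{-(j-j_Ω)}` beyond), with the remainder in the source's form `ρ_l = Rχ_lǧ_l`
(`r_l = O(χ_lǧ_l³)`), packaged as `WeightHyp`. With explicit constants (independent of `j_Ω`, as
in the source):

* below the cut-off (`GchHyp.sum_g_le_of_beta_ge`): if `β_l ≥ c` for all `l < k` outside an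
  exceptional set `E`, then `Σ_{l<k} ǧ_l ≤ (2/c) log(g₀/ǧ_k) + 4|E|g₀` — the perturbed version of
  "`Σ_l β_lḡ_l ≈ ∫dt/t`, `1 ≤ β_l/c + O(1_{β_l<c})`" in the proof of [BBS-rg-flow, Lemma 2.1(ii)(a)];
* beyond the cut-off: `Σ χ_l ≤ 1/(Ω-1)` (`sum_chi_tail_le`), `log(g₀/ǧ_n) ≤ log(g₀/ǧ_{n+d}) +
  Σ_{n≤l<n+d} ρ_lǧ_l` (`GchHyp.log_div_le_log_div_add`: the flow can only grow through `r_l`);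
* together (`GchHyp.sum_chi_mul_le`): **`Σ_{l<k} χ_lǧ_l ≤ (2/c) log(g₀/ǧ_k) + K₀`** for all `k`,
  `K₀ = 4Ng₀ + 2g₀/(Ω-1) + 2R/(c(Ω-1))`, hence `Σ_{l<k} ρ_l ≤ R((2/c) log(g₀/ǧ_k) + K₀)`
  (`GchHyp.sum_rho_le`);
* in the massive case `Σ_jβ_j < ∞` (`j_Ω < ∞` and `β_j = O(χ_j)`): a uniform lower bound on `ǧ_k`
  (`GchHyp.inv_le_uniform'`), so `ρ` is summable (`GchHyp.summable_rho`) and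
  `Σ_jρ_j ≤ R((2/c) log(g₀/ǧ_∞) + K₀)` (`GchHyp.tsum_rho_le`) — the `O(|log ǧ_∞|)` of
  "`ǧ_∞⁻¹ + O(|log ǧ_∞|) = g₀⁻¹ + 𝖡_{m²}`";
* **`ǧ_∞ · Σ_jβ_j → 1`** along any family of perturbed flows satisfying `GchHyp` and `WeightHyp`
  with uniform constants, `Σ_jβ_j → ∞` and `g₀ → ĝ₀ > 0` (`tendsto_limUnder_mul_tsum_of_weightHyp`):
  the second lemma of §8.3 ("`ǧ_∞ ∼ 1/𝖡_{m²}` as `m² ↓ 0`, `g₀ → ĝ₀`", given `Σ_jβ_j = 𝖡_{m²} → ∞`)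
  for the perturbed recursion, with the analytic inputs of its printed proof proved; what remains
  an input is the existence of the flow itself (`r_j`, an output of the renormalisation-group
  step), the verification of (A1) for the actual coefficients `β_j` ([BBS-rg-pt]), and the
  identification `Σ_jβ_j = 𝖡_{m²}` (the first lemma of §8.3, not treated here).

## References
* R. Bauerschmidt, D. C. Brydges, G. Slade, CMP 337 (2015), §6.1 (Assumption (A1)), §8.3 (the
  recursion for `ǧ` with remainder, (e:chigbd-bis) quoted from [BBS-rg-flow], the second lemma and
  its proof). [BauerschmidtBrydgesSlade2015LogCorr]
* R. Bauerschmidt, D. C. Brydges, G. Slade, Ann. Henri Poincaré 16 (2015), §1.2 (the cut-off time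
  `j_Ω`, `χ_j`), Assumption (A1), Lemma 2.1(ii)(a) and its proof. [BauerschmidtBrydgesSlade2015Flow]
-/

noncomputable section

open Filter Topology Finset
open scoped BigOperators

namespace Literature.Barriers.CriticalPhenomena

namespace CTWSAW

/-! ### Geometric tails of the weights `χ` -/

/-- `Σ_{i<d} Ω^{-(i+1)} ≤ 1/(Ω - 1)` for `Ω > 1`. [folklore] -/
theorem sum_inv_pow_succ_le {Ω : ℝ} (hΩ : 1 < Ω) (d : ℕ) :
    ∑ i ∈ range d, Ω⁻¹ ^ (i + 1) ≤ 1 / (Ω - 1) := by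
  have hq0 : 0 ≤ Ω⁻¹ := inv_nonneg.2 (by linarith)
  have hq1 : Ω⁻¹ < 1 := inv_lt_one_of_one_lt₀ hΩ
  have hs : Summable fun i : ℕ => Ω⁻¹ ^ i := summable_geometric_of_lt_one hq0 hq1
  have h1 : ∑ i ∈ range d, Ω⁻¹ ^ i ≤ (1 - Ω⁻¹)⁻¹ := by
    rw [← tsum_geometric_of_lt_one hq0 hq1]
    exact hs.sum_le_tsum (range d) fun i _ => pow_nonneg hq0 i
  have hΩ0 : (0 : ℝ) < Ω := by linarith
  calc ∑ i ∈ range d, Ω⁻¹ ^ (i + 1) = Ω⁻¹ * ∑ i ∈ range d, Ω⁻¹ ^ i := by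
        rw [mul_sum]; exact sum_congr rfl fun i _ => by ring
    _ ≤ Ω⁻¹ * (1 - Ω⁻¹)⁻¹ := mul_le_mul_of_nonneg_left h1 hq0
    _ = 1 / (Ω - 1) := by
        field_simp

/-- **The weight structure of Assumption (A1)** for the perturbed flow, at a finite cut-off time
`jm = j_Ω`: `β_l ≥ c > 0` for all `l ≤ j_Ω` outside an exceptional set of at most `N` indices
("for all but `c⁻¹` values of `j ≤ j_Ω`"); weights `0 ≤ χ_l ≤ 1` with `χ_{j_Ω+1+i} ≤ Ω^{-(i+1)}`
(`χ_j = Ω^{-(j-j_Ω)₊}`, `Ω > 1`); and the remainder bound in the source's form `ρ_l ≤ Rχ_lǧ_l`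
(`r_l = O(χ_lǧ_l³)`), with the smallness `Rg₀ ≤ c/24` ("`ḡ₀` sufficiently small"; constants
independent of `j_Ω` and `g₀`).
[cite: BauerschmidtBrydgesSlade2015Flow, §1.2 (j_Ω, χ_j) and Assumption (A1)]
[cite: BauerschmidtBrydgesSlade2015LogCorr, §6.1 (Assumption (A1)); §8.3 (r_j = O(χ_jǧ_j³))] -/
structure WeightHyp (β ρ g χ : ℕ → ℝ) (g₀ c R Ω : ℝ) (jm N : ℕ) : Prop where
  /-- `c > 0`. -/
  c_pos : 0 < c
  /-- `R ≥ 0`. -/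
  R_nonneg : 0 ≤ R
  /-- smallness of `g₀` relative to `c` and `R`. -/
  smallR : R * g₀ ≤ c / 24
  /-- (A1): `β_l ≥ c` for all but at most `N` values of `l ≤ j_Ω`. -/
  exc : ∃ E : Finset ℕ, E.card ≤ N ∧ ∀ l, l ≤ jm → l ∉ E → c ≤ β l
  /-- `χ_l ≥ 0`. -/
  chi_nonneg : ∀ l, 0 ≤ χ l
  /-- `χ_l ≤ 1`. -/
  chi_le_one : ∀ l, χ l ≤ 1
  /-- `Ω > 1`. -/
  one_lt : 1 < Ω
  /-- `χ_{j_Ω+1+i} ≤ Ω^{-(i+1)}`. -/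
  chi_decay : ∀ i, χ (jm + 1 + i) ≤ Ω⁻¹ ^ (i + 1)
  /-- `ρ_l ≤ Rχ_lǧ_l`. -/
  rho_le : ∀ l, ρ l ≤ R * χ l * g l

/-- `Σ_{i<d} χ_{j_Ω+1+i} ≤ 1/(Ω-1)`. [cite: BauerschmidtBrydgesSlade2015Flow, Lemma 2.1 (proof of (i): Σ_{l≥j_Ω}|β_l| ≤ Σ_n Ω^{-n} = O(1))] -/
theorem WeightHyp.sum_chi_tail_le {β ρ g χ : ℕ → ℝ} {g₀ c R Ω : ℝ} {jm N : ℕ}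
    (hw : WeightHyp β ρ g χ g₀ c R Ω jm N) (d : ℕ) :
    ∑ i ∈ range d, χ (jm + 1 + i) ≤ 1 / (Ω - 1) :=
  (sum_le_sum fun i _ => hw.chi_decay i).trans (sum_inv_pow_succ_le hw.one_lt d)

namespace GchHyp

variable {β ρ g χ : ℕ → ℝ} {B g₀ c R Ω : ℝ} {jm N : ℕ} (h : GchHyp β ρ g B g₀)
include h

/-! ### Below the cut-off: `Σ_{l<k} ǧ_l = O(log(g₀/ǧ_k))` from `β_l ≥ c` -/

/-- **Below the cut-off**: if `β_l ≥ c > 0` for all `l < k` outside a finite exceptional set `E`,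
and `ρ_l ≤ Rǧ_l` for `l < k` with `Rg₀ ≤ c/4`, then
`Σ_{l<k} ǧ_l ≤ (2/c) log(g₀/ǧ_k) + 4|E|g₀` (from `Σ_{l<k}β_lǧ_l ≤ log(g₀/ǧ_k) + Σ_{l<k}ρ_lǧ_l`,
`cǧ_l ≤ β_lǧ_l` off `E`, `ǧ_l ≤ 2g₀` on `E`, and `Σρ_lǧ_l ≤ 2Rg₀Σǧ_l`).
[cite: BauerschmidtBrydgesSlade2015Flow, Lemma 2.1 (proof of (ii)(a): n = 1, and 1 ≤ β_l/c + O(1_{β_l<c}))] -/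
theorem sum_g_le_of_beta_ge (hc : 0 < c) (hR : 0 ≤ R) (hRg : R * g₀ ≤ c / 4) (E : Finset ℕ)
    (k : ℕ) (hβ : ∀ l, l < k → l ∉ E → c ≤ β l) (hρR : ∀ l, l < k → ρ l ≤ R * g l) :
    ∑ l ∈ range k, g l ≤ 2 / c * Real.log (g₀ / g k) + 4 * E.card * g₀ := by
  -- (1) c Σ ǧ ≤ Σ βǧ + 2cg₀|E|
  have h1 : c * ∑ l ∈ range k, g l ≤ ∑ l ∈ range k, β l * g l + c * (2 * g₀) * E.card := by
    have hpt : ∀ l ∈ range k, c * g l ≤ β l * g l + (if l ∈ E then c * (2 * g₀) else 0) := by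
      intro l hl
      by_cases hlE : l ∈ E
      · rw [if_pos hlE]
        have := h.le_two_mul l
        have := mul_nonneg (h.beta_nonneg l) (h.g_pos l).le
        nlinarith
      · rw [if_neg hlE, add_zero]
        exact mul_le_mul_of_nonneg_right (hβ l (mem_range.1 hl) hlE) (h.g_pos l).le
    calc c * ∑ l ∈ range k, g l = ∑ l ∈ range k, c * g l := mul_sum _ _ _
      _ ≤ ∑ l ∈ range k, (β l * g l + if l ∈ E then c * (2 * g₀) else 0) := sum_le_sum hpt
      _ = ∑ l ∈ range k, β l * g l + ∑ l ∈ range k ∩ E, c * (2 * g₀) := by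
          rw [sum_add_distrib, sum_ite_mem]
      _ ≤ ∑ l ∈ range k, β l * g l + c * (2 * g₀) * E.card := by
          rw [sum_const, nsmul_eq_mul]
          have hcard : ((range k ∩ E).card : ℝ) ≤ E.card := by
            exact_mod_cast card_le_card inter_subset_right
          have h0 : 0 ≤ c * (2 * g₀) := by nlinarith [h.pos₀]
          nlinarith
  -- (2) Σ βǧ ≤ log(g₀/ǧ_k) + Σ ρǧ ≤ log(g₀/ǧ_k) + 2Rg₀ Σ ǧ
  have h2 := h.sum_beta_mul_le k
  have h3 : ∑ l ∈ range k, ρ l * g l ≤ 2 * R * g₀ * ∑ l ∈ range k, g l := by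
    rw [mul_sum]
    refine sum_le_sum fun l hl => ?_
    have hgl := h.g_pos l
    calc ρ l * g l ≤ R * g l * g l := mul_le_mul_of_nonneg_right (hρR l (mem_range.1 hl)) hgl.le
      _ ≤ R * (2 * g₀) * g l :=
          mul_le_mul_of_nonneg_right (mul_le_mul_of_nonneg_left (h.le_two_mul l) hR) hgl.le
      _ = 2 * R * g₀ * g l := by ring
  have hS0 : 0 ≤ ∑ l ∈ range k, g l := sum_nonneg fun l _ => (h.g_pos l).le
  -- (3) combine: (c/2) Σ ǧ ≤ log + 2cg₀|E|
  have key : c / 2 * ∑ l ∈ range k, g l ≤ Real.log (g₀ / g k) + c * (2 * g₀) * E.card := by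
    have : 2 * R * g₀ * ∑ l ∈ range k, g l ≤ c / 2 * ∑ l ∈ range k, g l :=
      mul_le_mul_of_nonneg_right (by linarith) hS0
    linarith
  have e : 2 / c * Real.log (g₀ / g k) + 4 * E.card * g₀ =
      (Real.log (g₀ / g k) + c * (2 * g₀) * E.card) / (c / 2) := by
    field_simp
    ring
  rw [e, le_div_iff₀ (by linarith)]
  linarith

/-! ### Beyond the cut-off: growth only through the remainder -/

/-- `log(g₀/ǧ_m) ≤ log(g₀/ǧ_{m+1}) + ρ_mǧ_m` (`ǧ_{m+1} ≤ ǧ_m + |r_m| ≤ ǧ_m(1 + ρ_mǧ_m)`).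
[cite: BauerschmidtBrydgesSlade2015LogCorr, §8.3 (the recursion for ǧ with remainder)] -/
theorem log_div_le_log_div_succ (m : ℕ) :
    Real.log (g₀ / g m) ≤ Real.log (g₀ / g (m + 1)) + ρ m * g m := by
  have hgm := h.g_pos m
  have hgm1 := h.g_pos (m + 1)
  have hρg : 0 ≤ ρ m * g m := mul_nonneg (h.rho_nonneg m) hgm.le
  have h1 : g (m + 1) ≤ g m * (1 + ρ m * g m) := by
    have := h.g_succ_le m
    have := h.rem_le m
    nlinarith
  have h2 : Real.log (g (m + 1)) ≤ Real.log (g m) + ρ m * g m :=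
    calc Real.log (g (m + 1)) ≤ Real.log (g m * (1 + ρ m * g m)) := Real.log_le_log hgm1 h1
      _ = Real.log (g m) + Real.log (1 + ρ m * g m) := Real.log_mul hgm.ne' (by linarith)
      _ ≤ Real.log (g m) + ρ m * g m := by
          have := Real.log_le_sub_one_of_pos (show 0 < 1 + ρ m * g m by linarith)
          linarith
  rw [Real.log_div h.pos₀.ne' hgm.ne', Real.log_div h.pos₀.ne' hgm1.ne']
  linarith

/-- `log(g₀/ǧ_n) ≤ log(g₀/ǧ_{n+d}) + Σ_{i<d} ρ_{n+i}ǧ_{n+i}`: beyond the cut-off the flow can only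
grow through the remainder. [cite: BauerschmidtBrydgesSlade2015LogCorr, §8.3 (the recursion for ǧ with remainder)] -/
theorem log_div_le_log_div_add (n d : ℕ) :
    Real.log (g₀ / g n) ≤ Real.log (g₀ / g (n + d)) + ∑ i ∈ range d, ρ (n + i) * g (n + i) := by
  induction d with
  | zero => simp
  | succ d ih =>
    rw [sum_range_succ, ← Nat.add_assoc]
    have := h.log_div_le_log_div_succ (n + d)
    linarith

/-! ### The weighted sums under `WeightHyp` -/

section weights

variable (hw : WeightHyp β ρ g χ g₀ c R Ω jm N)
include hw

/-- `Σ_{i<d} χ_{j_Ω+1+i}ǧ_{j_Ω+1+i} ≤ 2g₀/(Ω-1)`.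
[cite: BauerschmidtBrydgesSlade2015Flow, Lemma 2.1 (proof of (ii)(a): the terms beyond j_Ω, exponential decay)] -/
theorem sum_chi_mul_tail_le (d : ℕ) :
    ∑ i ∈ range d, χ (jm + 1 + i) * g (jm + 1 + i) ≤ 2 * g₀ / (Ω - 1) :=
  calc ∑ i ∈ range d, χ (jm + 1 + i) * g (jm + 1 + i)
      ≤ ∑ i ∈ range d, χ (jm + 1 + i) * (2 * g₀) :=
        sum_le_sum fun i _ => mul_le_mul_of_nonneg_left (h.le_two_mul _) (hw.chi_nonneg _)
    _ = 2 * g₀ * ∑ i ∈ range d, χ (jm + 1 + i) := by rw [← sum_mul, mul_comm]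
    _ ≤ 2 * g₀ * (1 / (Ω - 1)) :=
        mul_le_mul_of_nonneg_left (hw.sum_chi_tail_le d) (by linarith [h.pos₀])
    _ = 2 * g₀ / (Ω - 1) := by ring

/-- `Σ_{i<d} ρ_{j_Ω+1+i}ǧ_{j_Ω+1+i} ≤ R/(Ω-1)` (`ρ_lǧ_l ≤ Rχ_lǧ_l² ≤ Rχ_l`).
[cite: BauerschmidtBrydgesSlade2015Flow, Lemma 2.1 (proof of (ii)(a): the terms beyond j_Ω)] -/
theorem sum_rho_mul_tail_le (d : ℕ) :
    ∑ i ∈ range d, ρ (jm + 1 + i) * g (jm + 1 + i) ≤ R / (Ω - 1) := by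
  have hpt : ∀ i, ρ (jm + 1 + i) * g (jm + 1 + i) ≤ R * χ (jm + 1 + i) := by
    intro i
    set l := jm + 1 + i
    have hgl := h.g_pos l
    have hgl1 := h.g_le_one l
    calc ρ l * g l ≤ R * χ l * g l * g l := mul_le_mul_of_nonneg_right (hw.rho_le l) hgl.le
      _ ≤ R * χ l * 1 * 1 := by
          have h0 : 0 ≤ R * χ l := mul_nonneg hw.R_nonneg (hw.chi_nonneg l)
          have h1 : R * χ l * g l ≤ R * χ l * 1 := mul_le_mul_of_nonneg_left hgl1 h0
          exact mul_le_mul h1 hgl1 hgl.le (mul_nonneg h0 zero_le_one)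
      _ = R * χ l := by ring
  calc ∑ i ∈ range d, ρ (jm + 1 + i) * g (jm + 1 + i) ≤ ∑ i ∈ range d, R * χ (jm + 1 + i) :=
        sum_le_sum fun i _ => hpt i
    _ = R * ∑ i ∈ range d, χ (jm + 1 + i) := by rw [mul_sum]
    _ ≤ R * (1 / (Ω - 1)) := mul_le_mul_of_nonneg_left (hw.sum_chi_tail_le d) hw.R_nonneg
    _ = R / (Ω - 1) := by ring

/-- Below the cut-off, with the data of `WeightHyp`: for `k ≤ j_Ω + 1`,
`Σ_{l<k} ǧ_l ≤ (2/c) log(g₀/ǧ_k) + 4Ng₀`.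
[cite: BauerschmidtBrydgesSlade2015Flow, Lemma 2.1 (proof of (ii)(a), the case j ≤ j_Ω)] -/
theorem sum_g_le_of_le_cutoff {k : ℕ} (hk : k ≤ jm + 1) :
    ∑ l ∈ range k, g l ≤ 2 / c * Real.log (g₀ / g k) + 4 * N * g₀ := by
  obtain ⟨E, hEN, hE⟩ := hw.exc
  have hρR : ∀ l, l < k → ρ l ≤ R * g l := fun l _ =>
    calc ρ l ≤ R * χ l * g l := hw.rho_le l
      _ ≤ R * 1 * g l :=
          mul_le_mul_of_nonneg_right (mul_le_mul_of_nonneg_left (hw.chi_le_one l) hw.R_nonneg)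
            (h.g_pos l).le
      _ = R * g l := by ring
  have h1 := h.sum_g_le_of_beta_ge hw.c_pos hw.R_nonneg (by linarith [hw.smallR, hw.c_pos]) E k
    (fun l hl hlE => hE l (by omega) hlE) hρR
  have h2 : (4 : ℝ) * E.card * g₀ ≤ 4 * N * g₀ := by
    have : (E.card : ℝ) ≤ N := by exact_mod_cast hEN
    nlinarith [h.pos₀]
  linarith

/-- The constant `K₀ = 4Ng₀ + 2g₀/(Ω-1) + (2/c)(R/(Ω-1))` of `sum_chi_mul_le` (independent of `j_Ω`)
is nonnegative. [folklore] -/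
theorem K₀_nonneg : 0 ≤ 4 * N * g₀ + 2 * g₀ / (Ω - 1) + 2 / c * (R / (Ω - 1)) := by
  have := h.pos₀
  have := hw.c_pos
  have : 0 < Ω - 1 := by linarith [hw.one_lt]
  have := hw.R_nonneg
  positivity

/-- **`Σ_{l<k} χ_lǧ_l = O(|log ǧ_k|)` for the perturbed flow** (the case `n = 1` of
[BBS-rg-flow, Lemma 2.1(ii)(a)], with remainder): for every `k`,
`Σ_{l<k} χ_lǧ_l ≤ (2/c) log(g₀/ǧ_k) + K₀`, `K₀ = 4Ng₀ + 2g₀/(Ω-1) + (2/c)(R/(Ω-1))`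
(constants independent of `j_Ω` and `g₀`'s position in `(0, 1/2]`).
[cite: BauerschmidtBrydgesSlade2015Flow, Lemma 2.1(ii)(a) (n = 1, m = 0: Σ_{l=j}^k χ_lḡ_l ≤ C|log ḡ_k|)]
[cite: BauerschmidtBrydgesSlade2015LogCorr, §8.3 ((e:chigbd-bis) and Σ_l r_lǧ_l⁻² = O(Σ_lχ_lḡ_l) = O(log ǧ_k))] -/
theorem sum_chi_mul_le (k : ℕ) :
    ∑ l ∈ range k, χ l * g l ≤
      2 / c * Real.log (g₀ / g k) + (4 * N * g₀ + 2 * g₀ / (Ω - 1) + 2 / c * (R / (Ω - 1))) := by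
  have hc := hw.c_pos
  have hΩ1 : 0 < Ω - 1 := by linarith [hw.one_lt]
  have hχg : ∀ l, χ l * g l ≤ g l := fun l =>
    (mul_le_mul_of_nonneg_right (hw.chi_le_one l) (h.g_pos l).le).trans (one_mul _).le
  have hK1 : 0 ≤ 2 * g₀ / (Ω - 1) := div_nonneg (by linarith [h.pos₀]) hΩ1.le
  have hK2 : 0 ≤ 2 / c * (R / (Ω - 1)) :=
    mul_nonneg (div_nonneg (by norm_num) hc.le) (div_nonneg hw.R_nonneg hΩ1.le)
  rcases le_or_gt k (jm + 1) with hk | hk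
  · -- below the cut-off
    have h1 := h.sum_g_le_of_le_cutoff hw hk
    have h2 : ∑ l ∈ range k, χ l * g l ≤ ∑ l ∈ range k, g l := sum_le_sum fun l _ => hχg l
    linarith
  · -- k = (jm + 1) + d with d ≥ 1: split the sum at the cut-off
    obtain ⟨d, rfl⟩ := Nat.exists_eq_add_of_le hk.le
    rw [sum_range_add]
    have h1 := h.sum_g_le_of_le_cutoff hw (le_refl (jm + 1))
    have h2 : ∑ l ∈ range (jm + 1), χ l * g l ≤ ∑ l ∈ range (jm + 1), g l :=
      sum_le_sum fun l _ => hχg l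
    have h3 := h.log_div_le_log_div_add (jm + 1) d
    have h4 := h.sum_rho_mul_tail_le hw d
    have h5 := h.sum_chi_mul_tail_le hw d
    have h6 : 2 / c * Real.log (g₀ / g (jm + 1)) ≤
        2 / c * Real.log (g₀ / g (jm + 1 + d)) + 2 / c * (R / (Ω - 1)) := by
      rw [← mul_add]
      exact mul_le_mul_of_nonneg_left (by linarith) (div_nonneg (by norm_num) hc.le)
    linarith

/-- Hence `Σ_{l<k} ρ_l ≤ R((2/c) log(g₀/ǧ_k) + K₀)`: the summed remainder bound of
`WeaklySAWCouplingFlowRemainder.lean` is `O(|log ǧ_k|)`, as asserted in the source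
("`Σ_{l<k} r_lǧ_l⁻² = O(Σ_{l<k}χ_lḡ_l) = O(log ǧ_k)`").
[cite: BauerschmidtBrydgesSlade2015LogCorr, §8.3 (proof of the second lemma)] -/
theorem sum_rho_le (k : ℕ) :
    ∑ l ∈ range k, ρ l ≤
      R * (2 / c * Real.log (g₀ / g k) + (4 * N * g₀ + 2 * g₀ / (Ω - 1) + 2 / c * (R / (Ω - 1)))) :=
  calc ∑ l ∈ range k, ρ l ≤ ∑ l ∈ range k, R * (χ l * g l) :=
        sum_le_sum fun l _ => (hw.rho_le l).trans (mul_assoc _ _ _).le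
    _ = R * ∑ l ∈ range k, χ l * g l := by rw [mul_sum]
    _ ≤ _ := mul_le_mul_of_nonneg_left (h.sum_chi_mul_le hw k) hw.R_nonneg

/-! ### The massive case: summability of `ρ` and the `O(|log ǧ_∞|)` bound -/

/-- A uniform lower bound on `ǧ_k` in the massive case `Σ_jβ_j < ∞`:
`(1/2)ǧ_k⁻¹ ≤ g₀⁻¹ + Σ_jβ_j + 3RK₀` (from `inv_le`, `sum_rho_le` and `log(g₀/ǧ_k) < g₀ǧ_k⁻¹`,
using `(2B + 6R/c)g₀ ≤ 1/2`). [cite: BauerschmidtBrydgesSlade2015LogCorr, §8.3 (proof of the second lemma)] -/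
theorem inv_le_uniform' (hβ : Summable β) (k : ℕ) :
    1 / 2 * (g k)⁻¹ ≤ g₀⁻¹ + ∑' j, β j +
      3 * R * (4 * N * g₀ + 2 * g₀ / (Ω - 1) + 2 / c * (R / (Ω - 1))) := by
  set K₀ := 4 * N * g₀ + 2 * g₀ / (Ω - 1) + 2 / c * (R / (Ω - 1)) with hK₀
  have hc := hw.c_pos
  have h1 := h.inv_le k
  have hgk := h.g_pos k
  have hSk : ∑ j ∈ range k, β j ≤ ∑' j, β j := hβ.sum_le_tsum (range k) fun j _ => h.beta_nonneg j
  have hPk := h.sum_rho_le hw k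
  have hlog : Real.log (g₀ / g k) ≤ g₀ / g k - 1 := Real.log_le_sub_one_of_pos (div_pos h.pos₀ hgk)
  have hB := h.B_nonneg
  have hinv : 0 < (g k)⁻¹ := inv_pos.2 hgk
  have hR := hw.R_nonneg
  -- the log terms: (2B + 6R/c) log(g₀/ǧ_k) ≤ (2B + 6R/c) g₀ ǧ_k⁻¹ ≤ (1/2) ǧ_k⁻¹
  have hcoef : 0 ≤ 2 * B + 6 * R / c := by positivity
  have h2 : (2 * B + 6 * R / c) * Real.log (g₀ / g k) ≤ (2 * B + 6 * R / c) * g₀ * (g k)⁻¹ := by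
    calc (2 * B + 6 * R / c) * Real.log (g₀ / g k) ≤ (2 * B + 6 * R / c) * (g₀ / g k - 1) :=
          mul_le_mul_of_nonneg_left hlog hcoef
      _ ≤ (2 * B + 6 * R / c) * (g₀ / g k) := by nlinarith
      _ = (2 * B + 6 * R / c) * g₀ * (g k)⁻¹ := by rw [div_eq_mul_inv]; ring
  have h3 : (2 * B + 6 * R / c) * g₀ ≤ 1 / 2 := by
    have e : (2 * B + 6 * R / c) * g₀ = 2 * (B * g₀) + 6 / c * (R * g₀) := by ring
    rw [e]
    have : 6 / c * (R * g₀) ≤ 6 / c * (c / 24) :=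
      mul_le_mul_of_nonneg_left hw.smallR (div_nonneg (by norm_num) hc.le)
    have e2 : 6 / c * (c / 24) = 1 / 4 := by field_simp; ring
    linarith [h.small]
  have h4 : (2 * B + 6 * R / c) * g₀ * (g k)⁻¹ ≤ 1 / 2 * (g k)⁻¹ :=
    mul_le_mul_of_nonneg_right h3 hinv.le
  -- assemble
  have h5 : 3 * ∑ j ∈ range k, ρ j ≤ 6 * R / c * Real.log (g₀ / g k) + 3 * R * K₀ := by
    have e : 6 * R / c * Real.log (g₀ / g k) + 3 * R * K₀ = 3 * (R * (2 / c * Real.log (g₀ / g k) + K₀)) := by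
      ring
    rw [e]
    linarith
  have e3 : (2 * B + 6 * R / c) * Real.log (g₀ / g k) =
      2 * B * Real.log (g₀ / g k) + 6 * R / c * Real.log (g₀ / g k) := by ring
  linarith

/-- **`ρ` is summable** in the massive case (its partial sums are bounded, by `sum_rho_le` and the
uniform lower bound on `ǧ_k`). [cite: BauerschmidtBrydgesSlade2015LogCorr, §8.3 (proof of the second lemma)] -/
theorem summable_rho (hβ : Summable β) : Summable ρ := by
  set K₀ := 4 * N * g₀ + 2 * g₀ / (Ω - 1) + 2 / c * (R / (Ω - 1)) with hK₀
  set M := g₀⁻¹ + ∑' j, β j + 3 * R * K₀ with hM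
  have hc := hw.c_pos
  have hMpos : 0 < M := by
    have h1 : 0 < g₀⁻¹ := inv_pos.2 h.pos₀
    have h2 : 0 ≤ ∑' j, β j := tsum_nonneg h.beta_nonneg
    have h3 : 0 ≤ 3 * R * K₀ := by
      have := h.K₀_nonneg hw
      have := hw.R_nonneg
      positivity
    linarith
  -- uniform bound on the partial sums
  refine summable_of_sum_range_le h.rho_nonneg (c := R * (2 / c * Real.log (2 * g₀ * M) + K₀)) ?_
  intro k
  refine (h.sum_rho_le hw k).trans (mul_le_mul_of_nonneg_left ?_ hw.R_nonneg)
  have hgk := h.g_pos k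
  have hu := h.inv_le_uniform' hw hβ k
  -- g₀/ǧ_k ≤ 2g₀M
  have h1 : g₀ / g k ≤ 2 * g₀ * M := by
    rw [div_eq_mul_inv]
    have : (g k)⁻¹ ≤ 2 * M := by linarith
    calc g₀ * (g k)⁻¹ ≤ g₀ * (2 * M) := mul_le_mul_of_nonneg_left this h.pos₀.le
      _ = 2 * g₀ * M := by ring
  have h2 : Real.log (g₀ / g k) ≤ Real.log (2 * g₀ * M) :=
    Real.log_le_log (div_pos h.pos₀ hgk) h1
  have := mul_le_mul_of_nonneg_left h2 (div_nonneg (by norm_num : (0 : ℝ) ≤ 2) hc.le)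
  linarith

/-- **The `O(|log ǧ_∞|)` bound of the summed remainder**: in the massive case,
`Σ_jρ_j ≤ R((2/c) log(g₀/ǧ_∞) + K₀)` — the term "`O(|log ǧ_∞|)`" of
"`ǧ_∞⁻¹ + O(|log ǧ_∞|) = g₀⁻¹ + 𝖡_{m²}`" for the perturbed flow.
[cite: BauerschmidtBrydgesSlade2015LogCorr, §8.3 (proof of the second lemma: ǧ_∞⁻¹ + O(|log ǧ_∞|) = g₀⁻¹ + 𝖡_{m²})] -/
theorem tsum_rho_le (hβ : Summable β) :
    ∑' j, ρ j ≤ R * (2 / c * Real.log (g₀ / limUnder atTop g) +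
      (4 * N * g₀ + 2 * g₀ / (Ω - 1) + 2 / c * (R / (Ω - 1)))) := by
  have hρ := h.summable_rho hw hβ
  have hL := h.limUnder_pos hβ hρ
  have hT := h.tendsto_limUnder hρ
  have hc0 : Tendsto (fun _ : ℕ => g₀) atTop (𝓝 g₀) := tendsto_const_nhds
  have hrhs : Tendsto (fun k => R * (2 / c * Real.log (g₀ / g k) +
      (4 * N * g₀ + 2 * g₀ / (Ω - 1) + 2 / c * (R / (Ω - 1))))) atTop
      (𝓝 (R * (2 / c * Real.log (g₀ / limUnder atTop g) +
        (4 * N * g₀ + 2 * g₀ / (Ω - 1) + 2 / c * (R / (Ω - 1)))))) :=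
    ((((hc0.div hT hL.ne').log (div_pos h.pos₀ hL).ne').const_mul _).add tendsto_const_nhds).const_mul _
  exact le_of_tendsto_of_tendsto' hρ.tendsto_sum_tsum_nat hrhs fun k => h.sum_rho_le hw k

/-- The same bound in the shape `A + A'|log ǧ_∞|` used by `tendsto_limUnder_mul_tsum`:
`Σ_jρ_j ≤ R(K₀ + (2/c)|log g₀|) + (2R/c)|log ǧ_∞|`.
[cite: BauerschmidtBrydgesSlade2015LogCorr, §8.3 (proof of the second lemma: the O(|log ǧ_∞|) term)] -/
theorem tsum_rho_le_abs_log (hβ : Summable β) :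
    ∑' j, ρ j ≤ R * ((4 * N * g₀ + 2 * g₀ / (Ω - 1) + 2 / c * (R / (Ω - 1))) +
        2 / c * |Real.log g₀|) + 2 * R / c * |Real.log (limUnder atTop g)| := by
  have h1 := h.tsum_rho_le hw hβ
  have hρ := h.summable_rho hw hβ
  have hL := h.limUnder_pos hβ hρ
  have hc := hw.c_pos
  have hR := hw.R_nonneg
  have hlog : Real.log (g₀ / limUnder atTop g) ≤ |Real.log g₀| + |Real.log (limUnder atTop g)| := by
    rw [Real.log_div h.pos₀.ne' hL.ne']
    linarith [le_abs_self (Real.log g₀), neg_abs_le (Real.log (limUnder atTop g))]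
  have h2 : R * (2 / c * Real.log (g₀ / limUnder atTop g)) ≤
      R * (2 / c * (|Real.log g₀| + |Real.log (limUnder atTop g)|)) :=
    mul_le_mul_of_nonneg_left (mul_le_mul_of_nonneg_left hlog (div_nonneg (by norm_num) hc.le)) hR
  have e : R * (2 / c * (|Real.log g₀| + |Real.log (limUnder atTop g)|)) =
      R * (2 / c * |Real.log g₀|) + 2 * R / c * |Real.log (limUnder atTop g)| := by ring
  linarith [mul_add R (2 / c * Real.log (g₀ / limUnder atTop g))
    (4 * N * g₀ + 2 * g₀ / (Ω - 1) + 2 / c * (R / (Ω - 1)))]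

end weights

end GchHyp

/-! ### `ǧ_∞ ∼ 1/Σ_jβ_j` with the weighted-sum input discharged -/

/-- **The second lemma of §8.3 for the perturbed flow, all analytic inputs discharged**: along any
family of perturbed flows (`GchHyp`, with the (A1)-weight structure `WeightHyp` and uniform
constants `B, c, R, Ω, N`; the cut-off times `j_Ω(i)` arbitrary) in the massive case
(`Σ_jβ_j(i) < ∞`) with `Σ_jβ_j(i) → ∞` and `g₀(i) → ĝ₀ > 0`, one has `ǧ_∞(i) · Σ_jβ_j(i) → 1`.
In the source: `Σ_jβ_j = 𝖡_{m²}` (first lemma of §8.3) and `𝖡_{m²} → ∞` as `m² ↓ 0` ((1.8)), so this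
is "`ǧ_∞ ∼ 1/𝖡_{m²}` as `m² ↓ 0` and `g₀ → ĝ₀`"; what remains an input is the flow itself (the
remainder `r_j = O(χ_jǧ_j³)` is produced by the renormalisation-group step, §6.4, §7.1–§7.2, §8.1),
the verification of (A1) for the coefficients `β_j` of [BBS-rg-pt], and the identification
`Σ_jβ_j = 𝖡_{m²}` (first lemma of §8.3, not treated here).
[cite: BauerschmidtBrydgesSlade2015LogCorr, §8.3 (second lemma: ǧ_∞ ∼ 1/𝖡_{m²})]
[cite: BauerschmidtBrydgesSlade2015Flow, Assumption (A1), Lemma 2.1(ii)(a)] -/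
theorem tendsto_limUnder_mul_tsum_of_weightHyp {ι : Type*} {l : Filter ι}
    {βf ρf gf χf : ι → ℕ → ℝ} {jm : ι → ℕ} {B c R Ω : ℝ} {N : ℕ} {g0 : ι → ℝ} {ĝ₀ : ℝ}
    (hh : ∀ i, GchHyp (βf i) (ρf i) (gf i) B (g0 i))
    (hw : ∀ i, WeightHyp (βf i) (ρf i) (gf i) (χf i) (g0 i) c R Ω (jm i) N)
    (hβ : ∀ i, Summable (βf i)) (hS : Tendsto (fun i => ∑' j, βf i j) l atTop)
    (hg : Tendsto g0 l (𝓝 ĝ₀)) (hĝ₀ : 0 < ĝ₀) :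
    Tendsto (fun i => limUnder atTop (gf i) * ∑' j, βf i j) l (𝓝 1) := by
  rcases isEmpty_or_nonempty ι with hι | hι
  · rw [l.filter_eq_bot_of_isEmpty]; exact tendsto_bot
  obtain ⟨i₀⟩ := hι
  have hc : 0 < c := (hw i₀).c_pos
  have hR : 0 ≤ R := (hw i₀).R_nonneg
  have hΩ1 : 0 < Ω - 1 := by linarith [(hw i₀).one_lt]
  have hρ : ∀ i, Summable (ρf i) := fun i => (hh i).summable_rho (hw i) (hβ i)
  -- |log g₀(i)| < M eventually
  set M : ℝ := |Real.log ĝ₀| + 1 with hMdef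
  have hM : ∀ᶠ i in l, |Real.log (g0 i)| < M :=
    (((Real.continuousAt_log hĝ₀.ne').tendsto.comp hg).abs).eventually
      (eventually_lt_nhds (by rw [hMdef]; linarith))
  -- the j_Ω-independent constant, made g₀-independent using g₀ ≤ 1/2
  set K₁ : ℝ := 4 * N + 2 / (Ω - 1) + 2 / c * (R / (Ω - 1)) with hK₁
  refine tendsto_limUnder_mul_tsum (A := R * (K₁ + 2 / c * M)) (A' := 2 * R / c) hh hβ hρ
    (by positivity) ?_ hS hg hĝ₀
  filter_upwards [hM] with i hMi
  have h1 := (hh i).tsum_rho_le_abs_log (hw i) (hβ i)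
  have hg0 := (hh i).pos₀
  have hg1 : g0 i ≤ 1 := by linarith [(hh i).g₀_le]
  -- K₀(i) ≤ K₁
  have hK : 4 * N * g0 i + 2 * g0 i / (Ω - 1) + 2 / c * (R / (Ω - 1)) ≤ K₁ := by
    rw [hK₁]
    have h2 : (4 : ℝ) * N * g0 i ≤ 4 * N := by
      have : (0 : ℝ) ≤ 4 * N := by positivity
      nlinarith
    have h3 : 2 * g0 i / (Ω - 1) ≤ 2 / (Ω - 1) :=
      div_le_div_of_nonneg_right (by linarith) hΩ1.le
    linarith
  have h4 : R * ((4 * N * g0 i + 2 * g0 i / (Ω - 1) + 2 / c * (R / (Ω - 1))) +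
      2 / c * |Real.log (g0 i)|) ≤ R * (K₁ + 2 / c * M) := by
    refine mul_le_mul_of_nonneg_left (add_le_add hK ?_) hR
    exact mul_le_mul_of_nonneg_left hMi.le (div_nonneg (by norm_num) hc.le)
  linarith

end CTWSAW

end Literature.Barriers.CriticalPhenomena
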